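import Summits.AtomisticToContinuum.HydrodynamicLimit.Theorems.LambertianContactSwapContactAngleEquidistributionEqCentring
import Literature.MathematicalPhysics.KineticTheory.HardSphereCanonicalKSLimit
import HarnessLib

/-!
# Tools for integrating out the spectators of a midpoint-fibre integral (stub `stub_eqStaticFlux` of
# line `Sketch` v5, crux `LambertianContactSwap.ContactAngleEquidistribution`,
# stmt-AtomisticToContinuum-12097; lead `prover-line-stmt-AtomisticToContinuum-12097-c2-0`)

WHAT. Tools for the static identity `stub_eqStaticFlux` (file `…EqStaticFlux.lean`) and its
registered pointwise sub-goal `stub_eqStaticFluxPointwise`: under the homogeneous canonical hard-sphere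
Gibbs state, the midpoint-fibre integrand of a mark reading only `(x_mid, v_i, v_j, n)` is
`∏_k M(v_k) · (ε²⟪ω, v_j − v_i⟫)₊ Ψ(x_j, v_i, v_j, ω) · Ξ_ε(N+1)⁻¹ 𝟙[spectators in the pinned set]`.

HOW. `lintegral_pi_pair` (a function of two coordinates under a product of probability measures,
`lmarginal`); `volume_setOf_comp_equiv` (relabelling, `piCongrLeft`); `forall_sep_iff_pinnedHC` (the
hard-core constraint with a distinguished pair is the pinned event `PinnedHC`); `lintegral_ite_pinnedHC`
(integrating the positions: dummy position, Haar volume of the pinned set); `canonicalPartition_eq_XiT`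
(`𝒵_N = Ξ_ε(N+1)`); `lintegral_vel_pair` (the spectator Maxwellians integrate to one,
`pi_withDensity_eq`); Tonelli and algebra (`lintegral4_swap`, `lintegral_rhs_form`); the fibre geometry
(`mid_apply`, `fibre_pair_geometry`: the pair separation is `εω`, `fibre_sepVec_add_proj_add_proj`).

References: E. Pulvirenti, D. Tsagkarogiannis, Comm. Math. Phys. 316 (2012), §3, §5; D. Ruelle,
*Statistical Mechanics: Rigorous Results* (1969), §4.2.
-/

noncomputable section

open MeasureTheory Filter Set Topology ProbabilityTheory Function
open scoped ENNReal BigOperators Classical RealInnerProductSpace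

namespace Summit.AtomisticToContinuum.HydrodynamicLimit.Theorems.ContactAngleEquidistributionSketch

open Literature.Analysis.FluidPDE Literature.MathematicalPhysics.KineticTheory

namespace EqStaticFlux

/-! ### Generic tools -/

/-- Under a product of copies of a probability measure, a function of two distinct coordinates
integrates as over the two-fold product. [folklore] -/
theorem lintegral_pi_pair {α : Type*} [MeasurableSpace α] (γ : Measure α) [IsProbabilityMeasure γ]
    {n : ℕ} {i j : Fin n} (hij : i ≠ j) {H : α × α → ℝ≥0∞} (hH : Measurable H) :
    ∫⁻ v, H (v i, v j) ∂(Measure.pi fun _ : Fin n => γ) = ∫⁻ a, ∫⁻ b, H (a, b) ∂γ ∂γ := by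
  obtain ⟨a₀, -⟩ := nonempty_of_measure_ne_zero
    (ne_of_eq_of_ne (measure_univ (μ := γ)) one_ne_zero)
  have hf : Measurable fun v : Fin n → α => H (v i, v j) :=
    hH.comp ((measurable_pi_apply i).prodMk (measurable_pi_apply j))
  set rest : Finset (Fin n) := ((Finset.univ : Finset (Fin n)).erase i).erase j with hrest
  have hjr : j ∉ rest := Finset.notMem_erase j _
  have hir' : i ∉ rest := fun h => (Finset.mem_erase.1 (Finset.mem_of_mem_erase h)).1 rfl
  have hir : i ∉ insert j rest := by
    rw [Finset.mem_insert, not_or]; exact ⟨hij, hir'⟩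
  have huniv : (Finset.univ : Finset (Fin n)) = insert i (insert j rest) := by
    rw [hrest, Finset.insert_erase (Finset.mem_erase.2 ⟨hij.symm, Finset.mem_univ j⟩),
      Finset.insert_erase (Finset.mem_univ i)]
  rw [lintegral_eq_lmarginal_univ (fun _ => a₀), huniv, lmarginal_insert _ hf hir]
  refine lintegral_congr fun a => ?_
  rw [lmarginal_insert _ hf hjr]
  refine lintegral_congr fun b => ?_
  have hval : ∀ y : (k : ↥rest) → α,
      H (updateFinset (update (update (fun _ => a₀) i a) j b) rest y i,
        updateFinset (update (update (fun _ => a₀) i a) j b) rest y j) = H (a, b) := by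
    intro y
    simp only [updateFinset, dif_neg hir', dif_neg hjr, update_self, update_of_ne hij]
  simp only [lmarginal, hval, lintegral_const, measure_univ, mul_one]

/-- Relabelling the coordinates along a bijection of index types preserves the product volume of
an event. [folklore] -/
theorem volume_setOf_comp_equiv {ι ι' α : Type*} [Fintype ι] [Fintype ι'] [MeasureSpace α]
    [SigmaFinite (volume : Measure α)] (e : ι' ≃ ι) {P : (ι' → α) → Prop}
    (hP : MeasurableSet {g | P g}) :
    volume {y : ι → α | P fun l => y (e l)} = volume {g : ι' → α | P g} := by
  have hmp := volume_measurePreserving_piCongrLeft (fun _ : ι' => α) e.symm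
  have h : ∀ y : ι → α, (MeasurableEquiv.piCongrLeft (fun _ : ι' => α) e.symm) y = fun l => y (e l) := by
    intro y
    funext l
    simp [MeasurableEquiv.piCongrLeft, Equiv.piCongrLeft_apply_eq_cast]
  rw [← hmp.measure_preimage hP.nullMeasurableSet]
  congr 1
  ext y
  simp only [mem_preimage, mem_setOf_eq, h]

/-- **The hard-core constraint of a configuration with a distinguished pair as a pinned hard-core
event**: if `emb` enumerates the labels other than `i ≠ j`, then all centres are mutually at
minimal-image distance `≥ ε` iff the other centres avoid the pair `(X i, X j)` and each other and
the pair is itself compatible. [folklore] -/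
theorem forall_sep_iff_pinnedHC (ε : ℝ) {n m : ℕ} {i j : Fin n} (hij : i ≠ j) (X : Fin n → T3)
    {emb : Fin m → Fin n} (hinj : Injective emb) (hi : ∀ l, emb l ≠ i) (hj : ∀ l, emb l ≠ j)
    (hcov : ∀ k, k ≠ i → k ≠ j → ∃ l, emb l = k) :
    (∀ a b, a ≠ b → ε ≤ Torus.euclidDist (X a) (X b)) ↔ PinnedHC ε ![X i, X j] (X ∘ emb) := by
  simp only [PinnedHC, Ov, not_lt, comp_apply]
  constructor
  · intro h
    refine ⟨fun a b hab => ?_, fun l a => ?_, fun l l' hll' => h _ _ (hinj.ne hll')⟩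
    · fin_cases a <;> fin_cases b
      · exact absurd rfl hab
      · simpa using h i j hij
      · simpa using h j i hij.symm
      · exact absurd rfl hab
    · fin_cases a
      · simpa using h _ _ (hi l)
      · simpa using h _ _ (hj l)
  · rintro ⟨h1, h2, h3⟩ a b hab
    have hcls : ∀ k, k = i ∨ k = j ∨ ∃ l, emb l = k := fun k => by
      by_cases hki : k = i
      · exact Or.inl hki
      · by_cases hkj : k = j
        · exact Or.inr (Or.inl hkj)
        · exact Or.inr (Or.inr (hcov k hki hkj))
    have h01 : ε ≤ Torus.euclidDist (X i) (X j) := by simpa using h1 0 1 (by decide)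
    have h10 : ε ≤ Torus.euclidDist (X j) (X i) := by simpa using h1 1 0 (by decide)
    have h2i : ∀ l, ε ≤ Torus.euclidDist (X (emb l)) (X i) := fun l => by simpa using h2 l 0
    have h2j : ∀ l, ε ≤ Torus.euclidDist (X (emb l)) (X j) := fun l => by simpa using h2 l 1
    rcases hcls a with rfl | rfl | ⟨l, rfl⟩ <;> rcases hcls b with rfl | rfl | ⟨l', rfl⟩
    · exact absurd rfl hab
    · exact h01
    · rw [Torus.euclidDist_comm]; exact h2i l'
    · exact h10
    · exact absurd rfl hab
    · rw [Torus.euclidDist_comm]; exact h2j l'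
    · exact h2i l
    · exact h2j l
    · exact h3 l l' fun h => hab (by rw [h])

/-- **Integrating the positions of a pinned event**: over `(𝕋³)^n` (Haar probability), a function of
the `j`-th position times the indicator that the positions other than `i ≠ j` lie in the pinned
hard-core set of a pinned configuration `Y (x j)` integrates to `∫ h c · u_ε(Y c)(m) dc`: the dummy
position `x i` gives `1`, the others give the Haar volume of the pinned set (`lmarginal`, relabelling).
[cite: PulvirentiTsagkarogiannis2012, §3] -/
theorem lintegral_ite_pinnedHC (ε : ℝ) {n m : ℕ} {i j : Fin n} (hij : i ≠ j) {rest : Finset (Fin n)}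
    (hir : i ∉ rest) (hjr' : j ∉ rest) (huniv : (Finset.univ : Finset (Fin n)) = insert j (insert i rest))
    (e : ↥rest ≃ Fin m) {Y : T3 → Fin 2 → T3} (hY : Measurable Y) {h : T3 → ℝ≥0∞} (hh : Measurable h) :
    ∫⁻ x : Fin n → T3, (if PinnedHC ε (Y (x j)) (fun l => x (e.symm l)) then h (x j) else 0) =
      ∫⁻ c, h c * ENNReal.ofReal (pinnedXi ε (Y c) m) := by
  have hjr : j ∉ insert i rest := by
    rw [Finset.mem_insert, not_or]; exact ⟨hij.symm, hjr'⟩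
  have hXm : Measurable fun x : Fin n → T3 => fun l : Fin m => x (e.symm l) :=
    measurable_pi_lambda _ fun l => measurable_pi_apply _
  have hf : Measurable fun x : Fin n → T3 =>
      if PinnedHC ε (Y (x j)) (fun l => x (e.symm l)) then h (x j) else 0 :=
    Measurable.ite (measurableSet_setOf_pinnedHC ε (hY.comp (measurable_pi_apply j)) hXm)
      (hh.comp (measurable_pi_apply j)) measurable_const
  rw [volume_pi, lintegral_eq_lmarginal_univ (fun _ => (0 : T3)), huniv, lmarginal_insert _ hf hjr]
  refine lintegral_congr fun c => ?_
  rw [lmarginal_insert _ hf hir]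
  have hinner : ∀ a : T3, (∫⋯∫⁻_rest,
      (fun x : Fin n → T3 => if PinnedHC ε (Y (x j)) (fun l => x (e.symm l)) then h (x j) else 0)
        ∂fun _ => (volume : Measure T3)) (update (update (fun _ => (0 : T3)) j c) i a) =
      h c * ENNReal.ofReal (pinnedXi ε (Y c) m) := by
    intro a
    set x' : Fin n → T3 := update (update (fun _ : Fin n => (0 : T3)) j c) i a with hx'
    have hxj : ∀ y : (k : ↥rest) → T3, updateFinset x' rest y j = c := fun y => by
      simp only [updateFinset, dif_neg hjr', hx', update_of_ne hij.symm, update_self]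
    have hxe : ∀ (y : (k : ↥rest) → T3) (l : Fin m),
        updateFinset x' rest y (e.symm l) = y (e.symm l) := fun y l => by
      simp only [updateFinset, dif_pos (e.symm l).2, Subtype.coe_eta]
    have hSm : MeasurableSet {y : (k : ↥rest) → T3 | PinnedHC ε (Y c) fun l => y (e.symm l)} :=
      measurableSet_setOf_pinnedHC ε measurable_const
        (measurable_pi_lambda _ fun l => measurable_pi_apply _)
    have hval : ∀ y : (k : ↥rest) → T3,
        (if PinnedHC ε (Y (updateFinset x' rest y j)) (fun l => updateFinset x' rest y (e.symm l))
          then h (updateFinset x' rest y j) else 0) =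
        {y : (k : ↥rest) → T3 | PinnedHC ε (Y c) fun l => y (e.symm l)}.indicator
          (fun _ => h c) y := by
      intro y
      simp only [hxj, hxe]
      by_cases hp : PinnedHC ε (Y c) fun l => y (e.symm l)
      · rw [if_pos hp, indicator_of_mem (by exact hp)]
      · rw [if_neg hp, indicator_of_notMem (by exact hp)]
    calc (∫⋯∫⁻_rest,
          (fun x : Fin n → T3 => if PinnedHC ε (Y (x j)) (fun l => x (e.symm l)) then h (x j) else 0)
          ∂fun _ => (volume : Measure T3)) x'
        = ∫⁻ y : (k : ↥rest) → T3, {y : (k : ↥rest) → T3 |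
            PinnedHC ε (Y c) fun l => y (e.symm l)}.indicator (fun _ => h c) y
            ∂(Measure.pi fun _ : ↥rest => (volume : Measure T3)) := lintegral_congr hval
      _ = h c * volume {y : (k : ↥rest) → T3 | PinnedHC ε (Y c) fun l => y (e.symm l)} := by
          rw [lintegral_indicator_const hSm]
          rfl
      _ = h c * ENNReal.ofReal (pinnedXi ε (Y c) m) := by
          rw [volume_setOf_comp_equiv e.symm (measurableSet_pinnedSet ε (Y c) m), pinnedXi,
            ofReal_measureReal (measure_ne_top _ _)]
          rfl
  simp only [hinner, lintegral_const, measure_univ, mul_one]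

/-- **The normalisation of the homogeneous Gibbs density is the canonical hard-core probability**:
`𝒵_n(ε; M_θ) = Ξ_ε(n)` (the Maxwellians integrate to one, `canonicalPartition_eq_posPartition`, and the
position weight of the unit activity is the indicator of the non-overlap set). [folklore] -/
theorem canonicalPartition_eq_XiT {θ : ℝ} (hθ : 0 < θ) (ε : ℝ) (n : ℕ) :
    canonicalPartition (Torus.geometry (Fin 3)) ε n
        (localGibbsProfile (fun _ => 1) (fun _ => 0) (fun _ => θ)) = XiT ε n := by
  rw [canonicalPartition_eq_posPartition continuous_const continuous_const continuous_const
      (fun _ => zero_le_one) (fun _ => hθ), posPartition, XiT, pinnedXi]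
  have hW : posWeight (fun _ => (1 : ℝ)) ε n =
      (pinnedSet ε (fun a : Fin 0 => Fin.elim0 a) n).indicator 1 := by
    funext x
    have hset : x ∈ posDomain ε n ↔ x ∈ pinnedSet ε (fun a : Fin 0 => Fin.elim0 a) n := by
      simp [posDomain, pinnedSet, PinnedHC, Ov, not_lt]
    simp only [posWeight, Finset.prod_const_one]
    by_cases hx : x ∈ posDomain ε n
    · rw [indicator_of_mem hx, indicator_of_mem (hset.1 hx), Pi.one_apply]
    · rw [indicator_of_notMem hx, indicator_of_notMem (mt hset.2 hx)]
  rw [hW, integral_indicator_one (measurableSet_pinnedSet ε _ n)]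

/-- **The velocity integral**: against the product of `n` probability Maxwellians, a function of the
two velocities `(v_i, v_j)` integrates as against `M(a) da ⊗ M(b) db` (the other Maxwellians integrate
to one). [folklore] -/
theorem lintegral_vel_pair {θ : ℝ} (hθ : 0 < θ) {n : ℕ} {i j : Fin n} (hij : i ≠ j)
    {H : V3 × V3 → ℝ≥0∞} (hH : Measurable H) :
    ∫⁻ v : Fin n → V3, (∏ k, ENNReal.ofReal (localMaxwellian 1 θ 0 (v k))) * H (v i, v j) =
      ∫⁻ a, ENNReal.ofReal (localMaxwellian 1 θ 0 a) *
        ∫⁻ b, ENNReal.ofReal (localMaxwellian 1 θ 0 b) * H (a, b) := by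
  have hMm : Measurable fun v : V3 => ENNReal.ofReal (localMaxwellian 1 θ 0 v) :=
    (continuous_localMaxwellian 1 θ 0).measurable.ennreal_ofReal
  have hγ : (volume : Measure V3).withDensity (fun v => ENNReal.ofReal (localMaxwellian 1 θ 0 v)) =
      gaussMeasure (0 : V3) θ := withDensity_localMaxwellian_eq_gaussMeasure hθ 0
  have hsf : SigmaFinite ((volume : Measure V3).withDensity
      fun v => ENNReal.ofReal (localMaxwellian 1 θ 0 v)) := by
    rw [hγ]; infer_instance
  have hprodm : Measurable fun v : Fin n → V3 => ∏ k, ENNReal.ofReal (localMaxwellian 1 θ 0 (v k)) :=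
    Finset.measurable_prod _ fun k _ => hMm.comp (measurable_pi_apply k)
  have hvij : Measurable fun v : Fin n → V3 => H (v i, v j) :=
    hH.comp ((measurable_pi_apply i).prodMk (measurable_pi_apply j))
  have hpi : Measure.pi (fun _ : Fin n => gaussMeasure (0 : V3) θ) =
      (volume : Measure (Fin n → V3)).withDensity
        fun v => ∏ k, ENNReal.ofReal (localMaxwellian 1 θ 0 (v k)) := by
    have h := pi_withDensity_eq (fun _ : Fin n => (volume : Measure V3))
      (f := fun _ v => ENNReal.ofReal (localMaxwellian 1 θ 0 v)) (fun _ => hMm) (fun _ => hsf)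
    simp only [hγ] at h
    rw [volume_pi]
    exact h
  have hin : Measurable fun a => ∫⁻ b, H (a, b) ∂(volume : Measure V3).withDensity
      fun v => ENNReal.ofReal (localMaxwellian 1 θ 0 v) := hH.lintegral_prod_right'
  calc ∫⁻ v : Fin n → V3, (∏ k, ENNReal.ofReal (localMaxwellian 1 θ 0 (v k))) * H (v i, v j)
      = ∫⁻ v, H (v i, v j) ∂(volume : Measure (Fin n → V3)).withDensity
          fun v => ∏ k, ENNReal.ofReal (localMaxwellian 1 θ 0 (v k)) :=
        (lintegral_withDensity_eq_lintegral_mul _ hprodm hvij).symm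
    _ = ∫⁻ a, ∫⁻ b, H (a, b) ∂gaussMeasure (0 : V3) θ ∂gaussMeasure (0 : V3) θ := by
        rw [← hpi, lintegral_pi_pair _ hij hH]
    _ = _ := by
        rw [← hγ, lintegral_withDensity_eq_lintegral_mul _ hMm hin]
        refine lintegral_congr fun a => ?_
        have ha : Measurable fun b => H (a, b) := hH.comp measurable_prodMk_left
        rw [Pi.mul_apply, lintegral_withDensity_eq_lintegral_mul _ hMm ha]
        rfl

/-- Rearranging the constants of the right-hand side: `∫∫ K · M(v)M(w) · Φ · (p/X)` is
`X⁻¹ · (∫ M(a) ∫ M(b) (K Φ)) · p`. [folklore] -/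
theorem lintegral_rhs_form {M : V3 → ℝ} (hM0 : ∀ v, 0 ≤ M v) (K Φ : V3 → V3 → ℝ≥0∞) {p : ℝ}
    (hp : 0 ≤ p) (X : ℝ) :
    ∫⁻ v, ∫⁻ w, K v w * ENNReal.ofReal (M v * M w) * Φ v w * ENNReal.ofReal (p / X) =
      ENNReal.ofReal X⁻¹ * ((∫⁻ a, ENNReal.ofReal (M a) *
        ∫⁻ b, ENNReal.ofReal (M b) * (K a b * Φ a b)) * ENNReal.ofReal p) := by
  have hg : ∀ v w, K v w * ENNReal.ofReal (M v * M w) * Φ v w * ENNReal.ofReal (p / X) =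
      ENNReal.ofReal X⁻¹ * (ENNReal.ofReal (M v) * (ENNReal.ofReal (M w) * (K v w * Φ v w)) *
        ENNReal.ofReal p) := by
    intro v w
    rw [div_eq_mul_inv, ENNReal.ofReal_mul hp, ENNReal.ofReal_mul (hM0 v)]
    ring
  have h1 : ∀ v, ∫⁻ w, ENNReal.ofReal X⁻¹ * (ENNReal.ofReal (M v) *
      (ENNReal.ofReal (M w) * (K v w * Φ v w)) * ENNReal.ofReal p) =
      ENNReal.ofReal X⁻¹ * ((ENNReal.ofReal (M v) *
        ∫⁻ w, ENNReal.ofReal (M w) * (K v w * Φ v w)) * ENNReal.ofReal p) := by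
    intro v
    rw [lintegral_const_mul' _ _ ENNReal.ofReal_ne_top, lintegral_mul_const' _ _ ENNReal.ofReal_ne_top,
      lintegral_const_mul' _ _ ENNReal.ofReal_ne_top]
  simp only [hg, h1]
  rw [lintegral_const_mul' _ _ ENNReal.ofReal_ne_top, lintegral_mul_const' _ _ ENNReal.ofReal_ne_top]

/-- Tonelli for a fourfold iterated lower integral: the innermost variable becomes the outermost.
[folklore] -/
theorem lintegral4_swap {α β γ δ : Type*} [MeasurableSpace α] [MeasurableSpace β] [MeasurableSpace γ]
    [MeasurableSpace δ] {μa : Measure α} {μb : Measure β} {μc : Measure γ} {μd : Measure δ}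
    [SFinite μa] [SFinite μb] [SFinite μc] [SFinite μd] {g : α → β → γ → δ → ℝ≥0∞}
    (hg : Measurable fun p : α × β × γ × δ => g p.1 p.2.1 p.2.2.1 p.2.2.2) :
    ∫⁻ a, ∫⁻ b, ∫⁻ c, ∫⁻ d, g a b c d ∂μd ∂μc ∂μb ∂μa =
      ∫⁻ d, ∫⁻ a, ∫⁻ b, ∫⁻ c, g a b c d ∂μc ∂μb ∂μa ∂μd := by
  calc ∫⁻ a, ∫⁻ b, ∫⁻ c, ∫⁻ d, g a b c d ∂μd ∂μc ∂μb ∂μa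
      = ∫⁻ a, ∫⁻ b, ∫⁻ d, ∫⁻ c, g a b c d ∂μc ∂μd ∂μb ∂μa := by
        refine lintegral_congr fun a => lintegral_congr fun b => ?_
        exact lintegral_lintegral_swap ((hg.comp (show Measurable (fun q : γ × δ => (a, b, q.1, q.2)) by
          fun_prop)).aemeasurable)
    _ = ∫⁻ a, ∫⁻ d, ∫⁻ b, ∫⁻ c, g a b c d ∂μc ∂μb ∂μd ∂μa := by
        refine lintegral_congr fun a => ?_
        exact lintegral_lintegral_swap ((hg.comp (show Measurable
          (fun q : (β × δ) × γ => (a, q.1.1, q.2, q.1.2)) by fun_prop)).lintegral_prod_right'.aemeasurable)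
    _ = _ := lintegral_lintegral_swap ((hg.comp (show Measurable
          (fun q : ((α × δ) × β) × γ => (q.1.1.1, q.1.2, q.2, q.1.1.2)) by
            fun_prop)).lintegral_prod_right'.lintegral_prod_right'.aemeasurable)

/-! ### The fibre configuration -/

/-- Reading the fibre configuration `z` with particle `i` moved to `a` and particle `j` moved to
`b` (velocities unchanged). [folklore] -/
theorem mid_apply {n : ℕ} {i j : Fin n} (hij : i ≠ j) (a b : T3) (z : Config n (Fin 3) T3) :
    update (update z i (a, (z i).2)) j (b, (z j).2) i = (a, (z i).2) ∧
      update (update z i (a, (z i).2)) j (b, (z j).2) j = (b, (z j).2) ∧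
      (∀ k, k ≠ i → k ≠ j → update (update z i (a, (z i).2)) j (b, (z j).2) k = z k) ∧
      ∀ k, (update (update z i (a, (z i).2)) j (b, (z j).2) k).2 = (z k).2 := by
  refine ⟨by rw [update_of_ne hij, update_self], update_self _ _ _, fun k hki hkj => by
    rw [update_of_ne hkj, update_of_ne hki], fun k => ?_⟩
  by_cases hkj : k = j
  · subst hkj; rw [update_self]
  · by_cases hki : k = i
    · subst hki; rw [update_of_ne hkj, update_self]
    · rw [update_of_ne hkj, update_of_ne hki]

/-- On the midpoint fibre the pair geometry is explicit (`0 < ε < 1/2`, `‖ω‖ = 1`,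
`u = (ε/2)ω`): the separation of `(c + u, c − u)` is `εω`, the midpoint is `c` and the unit
normal is `ω`. [folklore] -/
theorem fibre_pair_geometry {ε : ℝ} (hε0 : 0 < ε) (hε : ε < 1 / 2) {ω : V3} (hω : ‖ω‖ = 1) (c : T3) :
    (Torus.geometry (Fin 3)).sepVec (c + Literature.Analysis.FunctionSpaces.Torus.proj ((ε / 2) • ω))
        (c + Literature.Analysis.FunctionSpaces.Torus.proj (-((ε / 2) • ω))) = ε • ω ∧
      (Torus.geometry (Fin 3)).translate (c + Literature.Analysis.FunctionSpaces.Torus.proj (-((ε / 2) • ω)))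
        ((2 : ℝ)⁻¹ • (ε • ω)) = c ∧
      ε⁻¹ • (ε • ω) = ω := by
  have hu : (ε / 2) • ω - -((ε / 2) • ω) = ε • ω := by
    rw [sub_neg_eq_add, ← add_smul]; congr 1; ring
  have h1 : ‖(ε / 2) • ω - -((ε / 2) • ω)‖ < 1 / 2 := by
    rwa [hu, norm_smul, hω, mul_one, Real.norm_of_nonneg hε0.le]
  refine ⟨by rw [fibre_sepVec_add_proj_add_proj h1, hu], ?_,
    by rw [smul_smul, inv_mul_cancel₀ hε0.ne', one_smul]⟩
  rw [Torus.geometry_translate, add_assoc, ← Literature.Analysis.FunctionSpaces.Torus.proj_add, smul_smul,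
    show (2 : ℝ)⁻¹ * ε = ε / 2 by ring, neg_add_cancel, Literature.Analysis.FunctionSpaces.Torus.proj_zero,
    add_zero]

end EqStaticFlux

open EqStaticFlux

/-- **Registered sub-goal `stub_eqStaticFluxPointwise` (tools of `stub_eqStaticFlux`, line `Sketch` v5):
the integrand at the fibre point, pointwise.** With particle `i` at `x_j + (ε/2)ω` and
particle `j` at `x_j − (ε/2)ω`: the hard-core indicator is the pinned hard-core event of the
spectator positions about the dumbbell (`forall_sep_iff_pinnedHC`), the Gibbs weight is
`Ξ_ε(N+1)⁻¹ ∏_k M(v_k)` (`canonicalPartition_eq_XiT`), and the mark reads `(x_j, v_i, v_j, ω)`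
(`fibre_pair_geometry`). [cite: PulvirentiTsagkarogiannis2012, §5] -/
theorem stub_eqStaticFluxPointwise {ε : ℝ} (hε0 : 0 < ε) (hεh : ε < 1 / 2) {θ : ℝ} (hθ : 0 < θ) {N m : ℕ}
    {i j : Fin (N + 1)} (hij : i ≠ j) (Ψ : T3 → V3 → V3 → V3 → ℝ≥0∞) {ω : V3} (hω : ‖ω‖ = 1)
    {emb : Fin m → Fin (N + 1)} (hinj : Function.Injective emb) (hi : ∀ l, emb l ≠ i) (hj : ∀ l, emb l ≠ j)
    (hcov : ∀ k, k ≠ i → k ≠ j → ∃ l, emb l = k) (z : Config (N + 1) (Fin 3) T3) :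
    ENNReal.ofReal (ε ^ (Fintype.card (Fin 3) - 1) * ⟪ω, (z j).2 - (z i).2⟫) *
        (hardSphereDomain (Torus.geometry (Fin 3)) (N + 1) ε).indicator
          (fun y => ENNReal.ofReal (canonicalDensity (Torus.geometry (Fin 3)) ε (N + 1)
              (localGibbsProfile (fun _ => 1) (fun _ => 0) (fun _ => θ)) y) *
            Ψ ((Torus.geometry (Fin 3)).translate (y j).1
                ((2 : ℝ)⁻¹ • (Torus.geometry (Fin 3)).sepVec (y i).1 (y j).1))
              (y i).2 (y j).2 (ε⁻¹ • (Torus.geometry (Fin 3)).sepVec (y i).1 (y j).1))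
          (Function.update (Function.update z i
              ((z j).1 + Literature.Analysis.FunctionSpaces.Torus.proj ((ε / 2) • ω), (z i).2)) j
            ((z j).1 + Literature.Analysis.FunctionSpaces.Torus.proj (-((ε / 2) • ω)), (z j).2)) =
      (∏ k, ENNReal.ofReal (localMaxwellian 1 θ 0 (z k).2)) *
        (ENNReal.ofReal (ε ^ (Fintype.card (Fin 3) - 1) * ⟪ω, (z j).2 - (z i).2⟫) *
          Ψ (z j).1 (z i).2 (z j).2 ω) *
        (ENNReal.ofReal (XiT ε (N + 1))⁻¹ *
          if PinnedHC ε ![(z j).1 + Literature.Analysis.FunctionSpaces.Torus.proj ((ε / 2) • ω),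
              (z j).1 + Literature.Analysis.FunctionSpaces.Torus.proj (-((ε / 2) • ω))]
            (fun l => (z (emb l)).1) then 1 else 0) := by
  obtain ⟨hmi, hmj, hmk, hm2⟩ := mid_apply hij
    ((z j).1 + Literature.Analysis.FunctionSpaces.Torus.proj ((ε / 2) • ω))
    ((z j).1 + Literature.Analysis.FunctionSpaces.Torus.proj (-((ε / 2) • ω))) z
  obtain ⟨hsab, htr, hunit⟩ := fibre_pair_geometry hε0 hεh hω (z j).1
  set y := update (update z i
      ((z j).1 + Literature.Analysis.FunctionSpaces.Torus.proj ((ε / 2) • ω), (z i).2)) j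
    ((z j).1 + Literature.Analysis.FunctionSpaces.Torus.proj (-((ε / 2) • ω)), (z j).2) with hy
  have hml : ∀ l, y (emb l) = z (emb l) := fun l => hmk _ (hi l) (hj l)
  have hDiff : y ∈ hardSphereDomain (Torus.geometry (Fin 3)) (N + 1) ε ↔
      PinnedHC ε ![(z j).1 + Literature.Analysis.FunctionSpaces.Torus.proj ((ε / 2) • ω),
          (z j).1 + Literature.Analysis.FunctionSpaces.Torus.proj (-((ε / 2) • ω))]
        fun l => (z (emb l)).1 := by
    rw [mem_hardSphereDomain]
    simp only [Torus.norm_geometry_sepVec]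
    refine (forall_sep_iff_pinnedHC ε hij (fun k => (y k).1) hinj hi hj hcov).trans ?_
    simp only [comp_def, hmi, hmj, hml]
  by_cases hD : y ∈ hardSphereDomain (Torus.geometry (Fin 3)) (N + 1) ε
  · rw [indicator_of_mem hD, if_pos (hDiff.1 hD)]
    have hρ : canonicalDensity (Torus.geometry (Fin 3)) ε (N + 1)
        (localGibbsProfile (fun _ => 1) (fun _ => 0) (fun _ => θ)) y =
        (XiT ε (N + 1))⁻¹ * ∏ k, localMaxwellian 1 θ 0 (z k).2 := by
      rw [canonicalDensity, canonicalPartition_eq_XiT hθ, indicator_of_mem hD, tensorPow]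
      congr 1
      refine Finset.prod_congr rfl fun k _ => ?_
      simp only [localGibbsProfile, hm2 k, one_mul]
    rw [hρ, hmi, hmj]
    dsimp only
    rw [hsab, htr, hunit, ENNReal.ofReal_mul (inv_nonneg.2 (XiT_nonneg ε _)),
      ENNReal.ofReal_prod_of_nonneg fun k _ => localMaxwellian_nonneg zero_le_one hθ.le _ _]
    ring
  · rw [indicator_of_notMem hD, if_neg (mt hDiff.2 hD)]
    simp

end Summit.AtomisticToContinuum.HydrodynamicLimit.Theorems.ContactAngleEquidistributionSketch

end
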